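import Literature.NumberTheory.Automorphic.UnitaryGroupTruncatedKernelMeasurable
import Literature.NumberTheory.Automorphic.UnitaryGroupArthurKernelClassInvariance
import Mathlib.MeasureTheory.Constructions.Polish.Basic
import HarnessLib

/-!
# The class kernels `k^T_𝔬` of the `𝔬`-expansion on `U(3)` are Borel functions, on `G(𝔸_F)` and on
# `G(F)\G(𝔸_F)` — the measurability half of «`k^T_𝔬` is integrable over `𝐙G\𝐆`»
(Rogawski, *Automorphic Representations of Unitary Groups in Three Variables* (1990), §2.2, p. 13:
«Furthermore, `k^T_𝔬` is integrable over `𝐙G\𝐆`. Let `J^T_𝔬(f)` denote its integral»; Arthur,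
*A trace formula for reductive groups I*, Duke Math. J. 45 (1978), Thm. 7.1 is stated class by class)

Topic `NumberTheory/Automorphic`; namespace `Literature.NumberTheory.Automorphic.UnitaryGroup`. THEOREMS
ONLY over accepted tree modules: no definition, no named fact, no `sorry`, no instance, no notation.
The class replay (LAW 3 = `𝔬`-expansion road of the T1-qs sub-line, cell `hodgecm-mathlib`, crux
H413) of ★ `UnitaryGroupTruncatedKernelMeasurable`, for an ARBITRARY class map
`cl : G(F) → ι` (★ `UnitaryGroupArthurKernelClassExpansion`: `kernelClass` = `K_𝔬`,
`borelSumClass`, `kernelBorelClass` = `K_{B,𝔬}`, `kernelBorelTailClass` = `1_{H > T} K_{B,𝔬}`,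
`truncatedKernelClass` = `k^T_𝔬`) and `f ∈ C(G(𝔸_F))` (compact support is NOT needed for
measurability: every class sum is a `tsum` over a countable index set of continuous functions, Mathlib
`Measurable.tsum`):

* §1 `measurable_kernelClass_diag` — `x ↦ K_𝔬(x, x)` is Borel (every `N`).
* §2 `measurable_borelSumClass_mul` — `(u, y) ↦ Σ_{β ∈ B(F)∩𝔬̲} f(y⁻¹ β u y)` is jointly Borel;
  `stronglyMeasurable_kernelBorelClass_diag`, `measurable_kernelBorelClass_diag` — `y ↦ K_{B,𝔬}(y, y)`
  is (strongly) measurable (parametric Bochner integral, Mathlib `StronglyMeasurable.integral_prod_left'`,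
  any s-finite `ν`, any `𝓕`); `measurable_kernelBorelTailClass` (`{H > T}` is open, ★
  `measurableSet_setOf_lt_borelHeight`). Every `N`.
* §3 (`N = 3`, `T > 0`) `finite_support_kernelBorelTailClass_translate` (★ `finite_setOf_lt_borelHeight`),
  `measurable_pseudoEisenstein_kernelBorelTailClass`, **`measurable_truncatedKernelClass`**, and — under
  Rogawski's two partition axioms `IsConjInvariant cl`, `IsUnipotentInvariantOnBorel cl`, a Haar `ν` and
  a fundamental domain `𝓕` of `N(F)` (the descent ★ `quotFun_truncatedKernelClass_toAutomorphicQuotient'`)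
  — **`measurable_quotFun_truncatedKernelClass`**, `aestronglyMeasurable_quotFun_truncatedKernelClass`:
  the descended `[g] ↦ k^T_𝔬(g⁻¹)` is Borel on `G(𝔸_F) ⧸ G(F)` (★ `measurable_quotient_iff` along the
  closed `G(F)`, ★ `isClosed_quotientSubgroup_quasiSplit`).

HC_CM is proved only modulo the 7 printed citations until rung 0 closes.

## References

* J. D. Rogawski, *Automorphic Representations of Unitary Groups in Three Variables*, Annals of
  Mathematics Studies 123 (1990), §2.2 (p. 13) [Rogawski1990].
* S. Shokranian, *The Selberg–Arthur Trace Formula*, LNM 1503 (1992), §5.1–§5.2 [Shokranian1992].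
-/

set_option autoImplicit false

noncomputable section

open MeasureTheory Measure NumberField IsDedekindDomain Topology Set
open scoped NNReal ENNReal

namespace Literature.NumberTheory.Automorphic

namespace UnitaryGroup

variable {F E : Type} [Field F] [NumberField F] [Field E] [NumberField E] [Algebra F E]
  {c : E ≃ₐ[F] E} {N : ℕ} {ι : Type*}

/-- `𝔸_E` is Hausdorff (local copy of the standard three-line argument). [folklore] -/
private theorem t2Space_adeleRing_E₉ : T2Space (AdeleRing (𝓞 E) E) := by
  haveI : T2Space (FiniteAdeleRing (𝓞 E) E) := inferInstanceAs <| T2Space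
    (RestrictedProduct (fun w : HeightOneSpectrum (𝓞 E) => w.adicCompletion E)
      (fun w => (w.adicCompletionIntegers E : Set (w.adicCompletion E))) Filter.cofinite)
  haveI : T2Space (InfiniteAdeleRing E) :=
    inferInstanceAs <| T2Space ((w : InfinitePlace E) → w.Completion)
  exact inferInstanceAs <| T2Space (InfiniteAdeleRing E × FiniteAdeleRing (𝓞 E) E)

/-- `G(F)` is countable (★ `countable_quotientSubgroup_quasiSplit` read through `A_G · G(F) = G(F)`).
[folklore] -/
private theorem countable_arithmeticSubgroup₉ : Countable (quasiSplit F E c N).arithmeticSubgroup := by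
  rw [← quotientSubgroup_quasiSplit]; exact countable_quotientSubgroup_quasiSplit

/-! ## §1 The class kernel diagonal `x ↦ K_𝔬(x, x)` is Borel (every `N`) -/

section KernelClass

variable [MeasurableSpace (quasiSplit F E c N).Adelic] [BorelSpace (quasiSplit F E c N).Adelic]

/-- **`(x, y) ↦ K_𝔬(x, y)` is jointly Borel** for continuous `f`: a `tsum` over the countable class
`{γ ∈ G(F) : cl γ = 𝔬}` of the continuous `(x, y) ↦ f(x⁻¹ γ y)` (Mathlib `Measurable.tsum`).
[cite: Rogawski1990, §2.2 (p. 13)] -/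
theorem measurable_kernelClass (cl : (quasiSplit F E c N).arithmeticSubgroup → ι) (i : ι)
    {f : (quasiSplit F E c N).Adelic → ℂ} (hf : Continuous f) :
    Measurable fun p : (quasiSplit F E c N).Adelic × (quasiSplit F E c N).Adelic => kernelClass cl i f p.1 p.2 := by
  haveI := secondCountableTopology_adeleRing E
  haveI : SecondCountableTopology (quasiSplit F E c N).Adelic :=
    inferInstanceAs (SecondCountableTopology (adelic F E c N ((StdForm.antidiagonal N).over E)))
  haveI : Countable (quasiSplit F E c N).arithmeticSubgroup := countable_arithmeticSubgroup₉
  haveI : Countable ↥(cl ⁻¹' {i}) := Subtype.countable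
  have hterm : ∀ γ : ↥(cl ⁻¹' {i}), Measurable fun p : (quasiSplit F E c N).Adelic × (quasiSplit F E c N).Adelic =>
      f (p.1⁻¹ * ((γ : (quasiSplit F E c N).arithmeticSubgroup) : (quasiSplit F E c N).Adelic) * p.2) := by
    intro γ
    have hc : Continuous fun p : (quasiSplit F E c N).Adelic × (quasiSplit F E c N).Adelic =>
        p.1⁻¹ * ((γ : (quasiSplit F E c N).arithmeticSubgroup) : (quasiSplit F E c N).Adelic) * p.2 :=
      ((continuous_fst.inv).mul continuous_const).mul continuous_snd
    exact (hf.comp hc).measurable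
  have heq : (fun p : (quasiSplit F E c N).Adelic × (quasiSplit F E c N).Adelic => kernelClass cl i f p.1 p.2) =
      fun p => ∑' γ : ↥(cl ⁻¹' {i}),
        f (p.1⁻¹ * ((γ : (quasiSplit F E c N).arithmeticSubgroup) : (quasiSplit F E c N).Adelic) * p.2) := by
    funext p; rfl
  rw [heq]
  exact Measurable.tsum hterm

/-- **`x ↦ K_𝔬(x, x)` is Borel** for continuous `f`. [cite: Rogawski1990, §2.2 (p. 13)] -/
theorem measurable_kernelClass_diag (cl : (quasiSplit F E c N).arithmeticSubgroup → ι) (i : ι)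
    {f : (quasiSplit F E c N).Adelic → ℂ} (hf : Continuous f) :
    Measurable fun x : (quasiSplit F E c N).Adelic => kernelClass cl i f x x := by
  haveI : Countable (quasiSplit F E c N).arithmeticSubgroup := countable_arithmeticSubgroup₉
  haveI : Countable ↥(cl ⁻¹' {i}) := Subtype.countable
  have hterm : ∀ γ : ↥(cl ⁻¹' {i}), Measurable fun x : (quasiSplit F E c N).Adelic =>
      f (x⁻¹ * ((γ : (quasiSplit F E c N).arithmeticSubgroup) : (quasiSplit F E c N).Adelic) * x) := by
    intro γ
    have hc : Continuous fun x : (quasiSplit F E c N).Adelic =>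
        x⁻¹ * ((γ : (quasiSplit F E c N).arithmeticSubgroup) : (quasiSplit F E c N).Adelic) * x :=
      ((continuous_id.inv).mul continuous_const).mul continuous_id
    exact (hf.comp hc).measurable
  have heq : (fun x : (quasiSplit F E c N).Adelic => kernelClass cl i f x x) =
      fun x => ∑' γ : ↥(cl ⁻¹' {i}),
        f (x⁻¹ * ((γ : (quasiSplit F E c N).arithmeticSubgroup) : (quasiSplit F E c N).Adelic) * x) := by
    funext x; rfl
  rw [heq]
  exact Measurable.tsum hterm

end KernelClass

/-! ## §2 The class Borel-kernel diagonal `y ↦ K_{B,𝔬}(y, y)` and its cut-off (every `N`) -/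

section BorelClass

variable [MeasurableSpace (quasiSplit F E c N).Adelic] [BorelSpace (quasiSplit F E c N).Adelic]
  [MeasurableSpace (adelicUnipotent F E c N)] [BorelSpace (adelicUnipotent F E c N)]

/-- **`(u, y) ↦ Σ_{β ∈ B(F), cl β = 𝔬} f(y⁻¹ β (u y))` is jointly Borel** on `N(𝔸_F) × G(𝔸_F)` for
continuous `f` (a countable `tsum` of continuous functions). [cite: Rogawski1990, §2.2 (p. 13)] -/
theorem measurable_borelSumClass_mul (cl : (quasiSplit F E c N).arithmeticSubgroup → ι) (i : ι)
    {f : (quasiSplit F E c N).Adelic → ℂ} (hf : Continuous f) :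
    Measurable fun q : adelicUnipotent F E c N × (quasiSplit F E c N).Adelic =>
      borelSumClass cl i f q.2 ((q.1 : (quasiSplit F E c N).Adelic) * q.2) := by
  haveI := secondCountableTopology_adeleRing E
  haveI : SecondCountableTopology (quasiSplit F E c N).Adelic :=
    inferInstanceAs (SecondCountableTopology (adelic F E c N ((StdForm.antidiagonal N).over E)))
  haveI : SecondCountableTopology (adelicUnipotent F E c N) :=
    TopologicalSpace.Subtype.secondCountableTopology _
  haveI : Countable (quasiSplit F E c N).arithmeticSubgroup := countable_arithmeticSubgroup₉
  haveI : Countable ↥(arithmeticBorel F E c N) := Subtype.countable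
  haveI : Countable ↥((fun β : arithmeticBorel F E c N => cl β) ⁻¹' {i}) := Subtype.countable
  have hterm : ∀ β : ↥((fun β : arithmeticBorel F E c N => cl β) ⁻¹' {i}),
      Measurable fun q : adelicUnipotent F E c N × (quasiSplit F E c N).Adelic =>
        f (q.2⁻¹ * (((β : arithmeticBorel F E c N) : (quasiSplit F E c N).arithmeticSubgroup) :
          (quasiSplit F E c N).Adelic) * (((q.1 : (quasiSplit F E c N).Adelic)) * q.2)) := by
    intro β
    have hc : Continuous fun q : adelicUnipotent F E c N × (quasiSplit F E c N).Adelic =>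
        q.2⁻¹ * (((β : arithmeticBorel F E c N) : (quasiSplit F E c N).arithmeticSubgroup) :
          (quasiSplit F E c N).Adelic) * (((q.1 : (quasiSplit F E c N).Adelic)) * q.2) :=
      ((continuous_snd.inv).mul continuous_const).mul
        ((continuous_subtype_val.comp continuous_fst).mul continuous_snd)
    exact (hf.comp hc).measurable
  have heq : (fun q : adelicUnipotent F E c N × (quasiSplit F E c N).Adelic =>
      borelSumClass cl i f q.2 ((q.1 : (quasiSplit F E c N).Adelic) * q.2)) =
      fun q => ∑' β : ↥((fun β : arithmeticBorel F E c N => cl β) ⁻¹' {i}),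
        f (q.2⁻¹ * (((β : arithmeticBorel F E c N) : (quasiSplit F E c N).arithmeticSubgroup) :
          (quasiSplit F E c N).Adelic) * (((q.1 : (quasiSplit F E c N).Adelic)) * q.2)) := by
    funext q; rfl
  rw [heq]
  exact Measurable.tsum hterm

/-- **`y ↦ K_{B,𝔬}(y, y)` is (strongly) measurable**: `K_{B,𝔬}(y, y) = ν(𝓕)⁻¹ ∫_𝓕 Σ_{β∈B(F)∩𝔬̲} f(y⁻¹ β u y) dν(u)`
is a parametric Bochner integral (against the s-finite `ν|_𝓕`) of the jointly Borel integrand of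
`measurable_borelSumClass_mul` (Mathlib `StronglyMeasurable.integral_prod_left'`). Every `N`, every
s-finite `ν`, every `𝓕`, continuous `f`. [cite: Rogawski1990, §2.2 (p. 13)] -/
theorem stronglyMeasurable_kernelBorelClass_diag {f : (quasiSplit F E c N).Adelic → ℂ} (hf : Continuous f)
    (ν : Measure (adelicUnipotent F E c N)) [SFinite ν] (𝓕 : Set (adelicUnipotent F E c N))
    (cl : (quasiSplit F E c N).arithmeticSubgroup → ι) (i : ι) :
    StronglyMeasurable fun y : (quasiSplit F E c N).Adelic => kernelBorelClass ν 𝓕 cl i f y y := by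
  have hF : StronglyMeasurable (fun q : adelicUnipotent F E c N × (quasiSplit F E c N).Adelic =>
      borelSumClass cl i f q.2 ((q.1 : (quasiSplit F E c N).Adelic) * q.2)) :=
    (measurable_borelSumClass_mul cl i hf).stronglyMeasurable
  have h := MeasureTheory.StronglyMeasurable.integral_prod_left' (μ := ν.restrict 𝓕) hF
  have heq : (fun y : (quasiSplit F E c N).Adelic => kernelBorelClass ν 𝓕 cl i f y y) =
      fun y => ((ν 𝓕).toReal⁻¹ : ℝ) • (fun y' : (quasiSplit F E c N).Adelic => ∫ u,
        (fun q : adelicUnipotent F E c N × (quasiSplit F E c N).Adelic =>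
          borelSumClass cl i f q.2 ((q.1 : (quasiSplit F E c N).Adelic) * q.2)) (u, y') ∂(ν.restrict 𝓕)) y := by
    funext y
    rw [kernelBorelClass_def, borelConstantTerm_def]
  rw [heq]
  exact h.const_smul ((ν 𝓕).toReal⁻¹ : ℝ)

/-- `y ↦ K_{B,𝔬}(y, y)` is measurable. [cite: Rogawski1990, §2.2 (p. 13)] -/
theorem measurable_kernelBorelClass_diag {f : (quasiSplit F E c N).Adelic → ℂ} (hf : Continuous f)
    (ν : Measure (adelicUnipotent F E c N)) [SFinite ν] (𝓕 : Set (adelicUnipotent F E c N))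
    (cl : (quasiSplit F E c N).arithmeticSubgroup → ι) (i : ι) :
    Measurable fun y : (quasiSplit F E c N).Adelic => kernelBorelClass ν 𝓕 cl i f y y :=
  (stronglyMeasurable_kernelBorelClass_diag hf ν 𝓕 cl i).measurable

variable [NeZero N]

/-- **The cut-off class Borel diagonal `1_{H > T} K_{B,𝔬}(y, y)` is measurable** (`{H > T}` is open,
★ `measurableSet_setOf_lt_borelHeight`). [cite: Rogawski1990, §2.2 (p. 13)] -/
theorem measurable_kernelBorelTailClass {f : (quasiSplit F E c N).Adelic → ℂ} (hf : Continuous f)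
    (ν : Measure (adelicUnipotent F E c N)) [SFinite ν] (𝓕 : Set (adelicUnipotent F E c N))
    (T : ℝ≥0) (cl : (quasiSplit F E c N).arithmeticSubgroup → ι) (i : ι) :
    Measurable (kernelBorelTailClass ν 𝓕 T cl i f) :=
  (measurable_kernelBorelClass_diag hf ν 𝓕 cl i).indicator (measurableSet_setOf_lt_borelHeight T)

end BorelClass

/-! ## §3 `k^T_𝔬` is Borel on `U(3)(𝔸_F)` and on the automorphic quotient -/

section Three

variable [MeasurableSpace (quasiSplit F E c 3).Adelic] [BorelSpace (quasiSplit F E c 3).Adelic]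
  [MeasurableSpace (adelicUnipotent F E c 3)] [BorelSpace (adelicUnipotent F E c 3)]

omit [MeasurableSpace (quasiSplit F E c 3).Adelic] [BorelSpace (quasiSplit F E c 3).Adelic]
  [BorelSpace (adelicUnipotent F E c 3)] in
/-- **The `δ`-sum of `k^T_𝔬` is a finite sum** (`T > 0`): only finitely many classes `B(F) δ` have
`H(δ x) > T` (★ `finite_setOf_lt_borelHeight`), and the class tail vanishes below the cut-off.
[cite: Rogawski1990, §2.2 (p. 13)] -/
theorem finite_support_kernelBorelTailClass_translate (ν : Measure (adelicUnipotent F E c 3))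
    (𝓕 : Set (adelicUnipotent F E c 3)) {T : ℝ≥0} (hT : 0 < T)
    (cl : (quasiSplit F E c 3).arithmeticSubgroup → ι) (i : ι) (f : (quasiSplit F E c 3).Adelic → ℂ)
    (x : (quasiSplit F E c 3).Adelic) :
    (Function.support fun q : Quotient (QuotientGroup.rightRel (arithmeticBorel F E c 3)) =>
      kernelBorelTailClass ν 𝓕 T cl i f
        (((q.out : (quasiSplit F E c 3).arithmeticSubgroup) : (quasiSplit F E c 3).Adelic) * x)).Finite := by
  refine (finite_setOf_lt_borelHeight x hT).subset fun q hq => ?_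
  by_contra hlt
  exact hq (kernelBorelTailClass_of_not_lt cl i f hlt)

/-- **The `δ`-sum `x ↦ Σ_δ 1_{H(δx) > T} K_{B,𝔬}(δx, δx)` is measurable** (`T > 0`): pointwise a finite
sum, hence the `tsum` over the countable `B(F)\G(F)` of measurable translates (Mathlib
`Measurable.tsum`). [cite: Rogawski1990, §2.2 (p. 13)] -/
theorem measurable_pseudoEisenstein_kernelBorelTailClass {f : (quasiSplit F E c 3).Adelic → ℂ}
    (hf : Continuous f) (ν : Measure (adelicUnipotent F E c 3)) [SFinite ν]
    (𝓕 : Set (adelicUnipotent F E c 3)) {T : ℝ≥0} (hT : 0 < T)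
    (cl : (quasiSplit F E c 3).arithmeticSubgroup → ι) (i : ι) :
    Measurable fun x : (quasiSplit F E c 3).Adelic =>
      pseudoEisenstein (kernelBorelTailClass ν 𝓕 T cl i f) x := by
  haveI : Countable ↥(quasiSplit F E c 3).arithmeticSubgroup := countable_arithmeticSubgroup₉
  haveI : Countable (Quotient (QuotientGroup.rightRel (arithmeticBorel F E c 3))) :=
    Quotient.countable
  have heq : (fun x : (quasiSplit F E c 3).Adelic => pseudoEisenstein (kernelBorelTailClass ν 𝓕 T cl i f) x) =
      fun x => ∑' q : Quotient (QuotientGroup.rightRel (arithmeticBorel F E c 3)),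
        kernelBorelTailClass ν 𝓕 T cl i f
          (((q.out : (quasiSplit F E c 3).arithmeticSubgroup) : (quasiSplit F E c 3).Adelic) * x) := by
    funext x
    rw [pseudoEisenstein_def]
    exact (tsum_eq_finsum (finite_support_kernelBorelTailClass_translate ν 𝓕 hT cl i f x)).symm
  rw [heq]
  refine Measurable.tsum fun q => ?_
  exact (measurable_kernelBorelTailClass hf ν 𝓕 T cl i).comp (measurable_const_mul _)

/-- **The class truncated kernel `k^T_𝔬` is Borel measurable on `U(3)(𝔸_F)`** for continuous `f`,
`T > 0`, every s-finite `ν`, every `𝓕`, every class map and class (§1 for the diagonal `K_𝔬(x, x)`,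
§§2–3 for the `δ`-sum). [cite: Rogawski1990, §2.2 (p. 13)] -/
theorem measurable_truncatedKernelClass {f : (quasiSplit F E c 3).Adelic → ℂ} (hf : Continuous f)
    (ν : Measure (adelicUnipotent F E c 3)) [SFinite ν] (𝓕 : Set (adelicUnipotent F E c 3))
    {T : ℝ≥0} (hT : 0 < T) (cl : (quasiSplit F E c 3).arithmeticSubgroup → ι) (i : ι) :
    Measurable (truncatedKernelClass ν 𝓕 T cl i f) := by
  have h1 := measurable_kernelClass_diag cl i hf
  have h2 := measurable_pseudoEisenstein_kernelBorelTailClass hf ν 𝓕 hT cl i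
  have heq : truncatedKernelClass ν 𝓕 T cl i f =
      fun x => kernelClass cl i f x x - pseudoEisenstein (kernelBorelTailClass ν 𝓕 T cl i f) x :=
    funext fun x => truncatedKernelClass_def ν 𝓕 T cl i f x
  rw [heq]
  exact h1.sub h2

/-- **The descended class truncated kernel `[g] ↦ k^T_𝔬(g⁻¹)` is Borel on the automorphic quotient
`G(𝔸_F) ⧸ G(F)`** under Rogawski's two partition axioms (`IsConjInvariant`,
`IsUnipotentInvariantOnBorel`), for a Haar measure `ν` of `N(𝔸_F)` and a fundamental domain `𝓕` of
`N(F)` (the honest descent ★ `quotFun_truncatedKernelClass_toAutomorphicQuotient'`): Borel measurability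
descends along the quotient by the closed `G(F)` (★ `measurable_quotient_iff`,
★ `isClosed_quotientSubgroup_quasiSplit`). [cite: Rogawski1990, §2.2 (p. 13)] -/
theorem measurable_quotFun_truncatedKernelClass {cl : (quasiSplit F E c 3).arithmeticSubgroup → ι}
    (hcl : IsConjInvariant cl) (hclN : IsUnipotentInvariantOnBorel F E c 3 cl)
    {f : (quasiSplit F E c 3).Adelic → ℂ} (hf : Continuous f)
    (ν : Measure (adelicUnipotent F E c 3)) [ν.IsHaarMeasure]
    {𝓕 : Set (adelicUnipotent F E c 3)} (h𝓕 : IsFundamentalDomain (rationalUnipotent F E c 3) 𝓕 ν)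
    {T : ℝ≥0} (hT : 0 < T) (i : ι) :
    Measurable ((quasiSplit F E c 3).quotFun (truncatedKernelClass ν 𝓕 T cl i f)) := by
  haveI := secondCountableTopology_adeleRing E
  haveI := locallyCompactSpace_adeleRing' E
  haveI : T2Space (quasiSplit F E c 3).Adelic :=
    inferInstanceAs (T2Space (adelic F E c 3 ((StdForm.antidiagonal 3).over E)))
  haveI : LocallyCompactSpace (quasiSplit F E c 3).Adelic :=
    inferInstanceAs (LocallyCompactSpace (adelic F E c 3 ((StdForm.antidiagonal 3).over E)))
  haveI : SecondCountableTopology (quasiSplit F E c 3).Adelic :=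
    inferInstanceAs (SecondCountableTopology (adelic F E c 3 ((StdForm.antidiagonal 3).over E)))
  -- `N(𝔸_F)` is second countable locally compact, so the Haar measure `ν` is s-finite
  haveI : T2Space (AdeleRing (𝓞 E) E) := t2Space_adeleRing_E₉ (E := E)
  haveI : LocallyCompactSpace (adelicUnipotent F E c 3) := by
    have hcl' : IsClosed ((adelicUnipotent F E c 3 : Set (quasiSplit F E c 3).Adelic)) := by
      change IsClosed (⇑(adelicVal F E c 3 ((StdForm.antidiagonal 3).over E)) ⁻¹'
        ((upperUnitriangular (Fin 3) (AdeleRing (𝓞 E) E) : Subgroup (GL (Fin 3) (AdeleRing (𝓞 E) E))) :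
          Set (GL (Fin 3) (AdeleRing (𝓞 E) E))))
      exact (isClosed_upperUnitriangular (R := AdeleRing (𝓞 E) E)).preimage continuous_subtype_val
    exact hcl'.locallyCompactSpace
  haveI : SecondCountableTopology (adelicUnipotent F E c 3) :=
    TopologicalSpace.Subtype.secondCountableTopology _
  letI : MeasurableSpace ((quasiSplit F E c 3).Adelic ⧸ (quasiSplit F E c 3).quotientSubgroup) :=
    (quasiSplit F E c 3).instMeasurableSpaceAutomorphicQuotient
  haveI : BorelSpace ((quasiSplit F E c 3).Adelic ⧸ (quasiSplit F E c 3).quotientSubgroup) :=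
    (quasiSplit F E c 3).instBorelSpaceAutomorphicQuotient
  have hmeas := (Literature.MeasureTheory.Group.measurable_quotient_iff
    (G := (quasiSplit F E c 3).Adelic) (H := (quasiSplit F E c 3).quotientSubgroup)
    isClosed_quotientSubgroup_quasiSplit
    (F := (quasiSplit F E c 3).quotFun (truncatedKernelClass ν 𝓕 T cl i f))).2
  have heq : (quasiSplit F E c 3).quotFun (truncatedKernelClass ν 𝓕 T cl i f) ∘
      (QuotientGroup.mk : (quasiSplit F E c 3).Adelic →
        (quasiSplit F E c 3).Adelic ⧸ (quasiSplit F E c 3).quotientSubgroup) =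
        fun g => truncatedKernelClass ν 𝓕 T cl i f g⁻¹ := by
    funext g
    exact quotFun_truncatedKernelClass_toAutomorphicQuotient' hcl hclN ν h𝓕 T i f g
  exact hmeas (heq ▸ (measurable_truncatedKernelClass hf ν 𝓕 hT cl i).comp measurable_inv)

/-- Hence the integrand of `J^T_𝔬(f)` is a.e.-strongly measurable for every measure `μ` on the
automorphic quotient (the measurability half of «`k^T_𝔬` is integrable»; `ℂ` is second countable).
[cite: Rogawski1990, §2.2 (p. 13)] -/
theorem aestronglyMeasurable_quotFun_truncatedKernelClass
    {cl : (quasiSplit F E c 3).arithmeticSubgroup → ι}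
    (hcl : IsConjInvariant cl) (hclN : IsUnipotentInvariantOnBorel F E c 3 cl)
    {f : (quasiSplit F E c 3).Adelic → ℂ} (hf : Continuous f)
    (ν : Measure (adelicUnipotent F E c 3)) [ν.IsHaarMeasure]
    {𝓕 : Set (adelicUnipotent F E c 3)} (h𝓕 : IsFundamentalDomain (rationalUnipotent F E c 3) 𝓕 ν)
    {T : ℝ≥0} (hT : 0 < T) (i : ι) (μ : Measure (quasiSplit F E c 3).automorphicQuotient) :
    AEStronglyMeasurable ((quasiSplit F E c 3).quotFun (truncatedKernelClass ν 𝓕 T cl i f)) μ :=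
  (measurable_quotFun_truncatedKernelClass hcl hclN hf ν h𝓕 hT i).aestronglyMeasurable

end Three

end UnitaryGroup

end Literature.NumberTheory.Automorphic
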